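import Mathlib
import Summits.KontsevichZagierPeriods.Zeta5Search.RecordRayCell1011
import HarnessLib

/-!
# ζ(5) search — the record ray's cell `9n < p ≤ 10n`: every class has `E_x ≥ −7`, `casLB ≥ −11` (sharp), `N_p = 19`, and the PATH node there

Cell `pub-zeta5` (HONEST FRAMING: systematic search; no irrationality claim unless certified), TRACK «DENOM-LAW» D1 prover seat
(denom-prover-d1 g11, `HOME/denom-law/prover-d1/ATTEMPT-11.md` §8).  The last first-period cell of Brown–Zudilin's record ray `b(n) = n·(41;17,…,11)`
(the 28 forms are `< 2p` iff `p > 9n`).  For `9n < p ≤ 10n` every class has four or five points (`x + 3p < 4p ≤ 40n`; `x + 4p ≤ 41n` iff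
`x ≤ 41n − 4p`), and the depth bookkeeping gives `E_x ≥ −7` for EVERY class (sharp: `x + p ∈ [14n, 20n)`), hence `casLB(b(n),p) ≥ −11` (`VB ≥ −7`,
rows `≥ −4`; the census value) and, by THEOREM LB, `v_p(Cas_j(b(n))) ≥ −11`.  Here `⌊d/p⌋ = 2`, `N_p = 19`, `C⋆ ≤ 11`, so the PATH ACCOUNTING node's
value is `2 − 19 − min(1, 5 − C⋆) ≤ −11`: `PathAccountingFirstPeriod`'s literal conclusion holds on this cell (`pathAccounting_bRec_cell0910`).
Integer bookkeeping; nothing about irrationality.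
-/

open Finset

namespace Summit.KontsevichZagierPeriods.Zeta5Search.RecordRay0910

open Summit.KontsevichZagierPeriods.Zeta5Search.ClusterValuation
open Summit.KontsevichZagierPeriods.Zeta5Search.CasoratianValuation (InPolytope pairFloors refund shift casoratian)
open Summit.KontsevichZagierPeriods.Zeta5Search.WedgeDictionary (dOf)
open Summit.KontsevichZagierPeriods.Zeta5Search.CellA
open Summit.KontsevichZagierPeriods.Zeta5Search.RecordRayTop (self_mem_class add_mem_class)
open Summit.KontsevichZagierPeriods.Zeta5Search.RecordRayMid14 (dep7_le_low dep7_le_high netExp_ge mem2 classExp_ge_sub)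
open Summit.KontsevichZagierPeriods.Zeta5Search.RecordRay1112 (mem3)
open Summit.KontsevichZagierPeriods.Zeta5Search.RecordRay1011 (mem4 mem_class_cases5)
open Summit.KontsevichZagierPeriods.Zeta5Search.DenomLaw (cStar)
open Summit.KontsevichZagierPeriods.Zeta5Search.DenomLaw.FirstPeriodKit (cStar_le_eleven)

section Cell

variable {n p x : ℕ} (hp9 : 9 * n < p) (hp10 : p ≤ 10 * n) (hx : x < p)

include hp9 hp10 hx in
/-- **Every class has `E_x ≥ −7`** for `9n < p ≤ 10n`. -/
theorem classExp_ge_neg7 : (-7 : ℤ) ≤ classExp (bRec n) p x := by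
  have hv41 : x + p ≤ 41 * n := by omega
  have hw41 : x + 2 * p ≤ 41 * n := by omega
  have hu : x + 3 * p ≤ 41 * n := by omega
  have gx := netExp_ge n x
  have gv := netExp_ge n (x + p)
  have gw := netExp_ge n (x + 2 * p)
  have gu := netExp_ge n (x + 3 * p)
  have d1le := dep7_le n (x + p)
  have d2le := dep7_le n (x + 2 * p)
  have d3le := dep7_le_high (n := n) (q := x + 3 * p) (k := 3) (by norm_num) (by omega)
  have e0 : dep7 n x = 0 := dep7_low (by omega)
  rw [e0] at gx
  push_cast at gx
  have hsub4 : ({x, x + p, x + 2 * p, x + 3 * p} : Finset ℕ) ⊆ classSet (bRec n) p x := by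
    intro s hs
    rw [mem_insert] at hs
    rcases hs with rfl | hs
    · exact self_mem_class (by omega) hx
    rw [mem_insert] at hs
    rcases hs with rfl | hs
    · exact add_mem_class hv41
    rw [mem_insert, mem_singleton] at hs
    rcases hs with rfl | rfl
    · exact mem2 hw41
    · exact mem3 hu
  by_cases hz : x + 4 * p ≤ 41 * n
  · -- five points: `x + 4p > 36n` a zero
    have gz := netExp_ge n (x + 4 * p)
    have e4 : dep7 n (x + 4 * p) = 0 := dep7_high (by omega)
    rw [e4] at gz
    push_cast at gz
    have hsub5 : ({x, x + p, x + 2 * p, x + 3 * p, x + 4 * p} : Finset ℕ) ⊆ classSet (bRec n) p x := by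
      intro s hs
      rw [mem_insert] at hs
      rcases hs with rfl | hs
      · exact self_mem_class (by omega) hx
      rw [mem_insert] at hs
      rcases hs with rfl | hs
      · exact add_mem_class hv41
      rw [mem_insert] at hs
      rcases hs with rfl | hs
      · exact mem2 hw41
      rw [mem_insert, mem_singleton] at hs
      rcases hs with rfl | rfl
      · exact mem3 hu
      · exact mem4 hz
    have hrest : ∀ s ∈ classSet (bRec n) p x, s ∉ ({x, x + p, x + 2 * p, x + 3 * p, x + 4 * p} : Finset ℕ) →
        0 ≤ netExp (bRec n) s := by
      intro s hs hns
      rcases mem_class_cases5 (by omega) hx hs with rfl | rfl | rfl | ⟨rfl, -⟩ | ⟨rfl, -⟩ <;> simp at hns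
    have hE := classExp_ge_sub ({x, x + p, x + 2 * p, x + 3 * p, x + 4 * p} : Finset ℕ) hsub5 hrest
    rw [sum_insert (by simp; omega), sum_insert (by simp; omega), sum_insert (by simp; omega), sum_pair (by omega)] at hE
    -- `d₁ + d₂ + d₃ ≤ 10` (`x + 3p > 27n` has depth ≤ 3, and less as `x + p` climbs)
    have h10 : dep7 n (x + p) + dep7 n (x + 2 * p) + dep7 n (x + 3 * p) ≤ 10 := by
      by_cases h1 : x + p < 11 * n
      · have : dep7 n (x + p) = 0 := dep7_low h1
        omega
      by_cases h2 : x + p < 12 * n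
      · have := dep7_le_low (n := n) (q := x + p) (k := 1) (by norm_num) (by omega)
        have := dep7_le_high (n := n) (q := x + 3 * p) (k := 1) (by norm_num) (by omega)
        omega
      by_cases h3 : x + p < 13 * n
      · have := dep7_le_low (n := n) (q := x + p) (k := 2) (by norm_num) (by omega)
        have : dep7 n (x + 3 * p) = 0 := dep7_high (by omega)
        omega
      by_cases h4 : x + p < 14 * n
      · have := dep7_le_low (n := n) (q := x + p) (k := 3) (by norm_num) (by omega)
        have : dep7 n (x + 3 * p) = 0 := dep7_high (by omega)
        omega
      · exfalso; omega
    have : ((dep7 n (x + p) : ℕ) : ℤ) + ((dep7 n (x + 2 * p) : ℕ) : ℤ) + ((dep7 n (x + 3 * p) : ℕ) : ℤ) ≤ 10 := by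
      exact_mod_cast h10
    linarith
  · -- four points: `x + 3p > 41n − p ≥ 31n` is a zero, and `d₁ + d₂ ≤ 11`
    have e3 : dep7 n (x + 3 * p) = 0 := dep7_high (by omega)
    rw [e3] at gu
    push_cast at gu
    have hrest : ∀ s ∈ classSet (bRec n) p x, s ∉ ({x, x + p, x + 2 * p, x + 3 * p} : Finset ℕ) → 0 ≤ netExp (bRec n) s := by
      intro s hs hns
      rcases mem_class_cases5 (by omega) hx hs with rfl | rfl | rfl | ⟨rfl, -⟩ | ⟨rfl, h4⟩
      · simp at hns
      · simp at hns
      · simp at hns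
      · simp at hns
      · omega
    have hE := classExp_ge_sub ({x, x + p, x + 2 * p, x + 3 * p} : Finset ℕ) hsub4 hrest
    rw [sum_insert (by simp; omega), sum_insert (by simp; omega), sum_pair (by omega)] at hE
    have h11 : dep7 n (x + p) + dep7 n (x + 2 * p) ≤ 11 := by
      by_cases h4 : x + p < 15 * n
      · have := dep7_le_low (n := n) (q := x + p) (k := 4) (by norm_num) (by omega)
        omega
      by_cases h5 : x + p < 16 * n
      · have := dep7_le_low (n := n) (q := x + p) (k := 5) (by norm_num) (by omega)
        have := dep7_le_high (n := n) (q := x + 2 * p) (k := 6) (by norm_num) (by omega)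
        omega
      by_cases h6 : x + p < 17 * n
      · have := dep7_le_low (n := n) (q := x + p) (k := 6) (by norm_num) (by omega)
        have := dep7_le_high (n := n) (q := x + 2 * p) (k := 5) (by norm_num) (by omega)
        omega
      · have := dep7_le_high (n := n) (q := x + 2 * p) (k := 4) (by norm_num) (by omega)
        omega
    have : ((dep7 n (x + p) : ℕ) : ℤ) + ((dep7 n (x + 2 * p) : ℕ) : ℤ) ≤ 11 := by exact_mod_cast h11
    linarith

end Cell

/-- **`casLB(b(n),p) ≥ −11`** for `9n < p ≤ 10n` (`VB ≥ −7`, rows `≥ −4`; the census value of the cell). -/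
theorem casLB_ge0910 {n p : ℕ} (hp9 : 9 * n < p) (hp10 : p ≤ 10 * n) : -11 ≤ casLB (bRec n) p := by
  rcases casLB_ge_or_noPole (bRec n) p (-7) (-4)
      (fun x hx _ => (classExp_ge_neg7 hp9 hp10 hx).trans (classExp_le_classNu _ _ _)) (by norm_num)
      (fun x hx _ => by linarith [classExp_ge_neg7 hp9 hp10 hx]) (fun _ => by norm_num) with ⟨h0, -⟩ | h
  · rw [h0]; norm_num
  · linarith

/-- **`v_p(Cas_j(b(n))) ≥ −11`** on `9n < p ≤ 10n` (THEOREM LB). -/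
theorem cas_ge_neg11 (n j p : ℕ) (hn : 1 ≤ n) (hj1 : 1 ≤ j) (hj7 : j ≤ 7) (hprime : p.Prime) (hp9 : 9 * n < p) (hp10 : p ≤ 10 * n)
    (hwin : (41 * n + 2 : ℤ) < (p : ℤ) ^ 2) (hcas : casoratian (bRec n) j ≠ 0) :
    (-11 : ℤ) ≤ padicValRat p (casoratian (bRec n) j) := by
  have hb0 : (bRec n 0 + 2 : ℤ) < (p : ℤ) ^ 2 := by rw [bRec_zero]; exact_mod_cast hwin
  have h := casoratianClassBound_holds (bRec n) j p (inPolytope_bRec n) hj1 hj7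
    (inPolytope_shift_bRec n j hn hj1 hj7) hprime (by omega) hb0 hcas
  linarith [casLB_ge0910 hp9 hp10]

/-- **`N_p(b(n)) = 19`** for `9n < p ≤ 10n` (pair blocks `c·n`, `c = 10,…,18`, counted `2,2,3,3,3,2,2,1,1` times, each exactly once). -/
theorem pairFloors_bRec_0910 {n p : ℕ} (hp9 : 9 * n < p) (hp10 : p ≤ 10 * n) : pairFloors (bRec n) p = 19 := by
  have hp0 : (0 : ℤ) < p := by exact_mod_cast (show 0 < p by omega)
  have hq0 : ∀ (a b : ℤ), 0 ≤ (n : ℤ) * 41 - (n : ℤ) * a - (n : ℤ) * b → (n : ℤ) * 41 - (n : ℤ) * a - (n : ℤ) * b < p →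
      ((n : ℤ) * 41 - (n : ℤ) * a - (n : ℤ) * b) / (p : ℤ) = 0 := fun a b h0 h1 => Int.ediv_eq_zero_of_lt h0 h1
  have hq1 : ∀ (a b : ℤ), (p : ℤ) ≤ (n : ℤ) * 41 - (n : ℤ) * a - (n : ℤ) * b → (n : ℤ) * 41 - (n : ℤ) * a - (n : ℤ) * b < 2 * p →
      ((n : ℤ) * 41 - (n : ℤ) * a - (n : ℤ) * b) / (p : ℤ) = 1 := by
    intro a b h1 h2
    rw [Int.ediv_eq_iff_of_pos hp0]; constructor <;> omega
  unfold pairFloors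
  simp only [sum_range_succ, sum_range_zero, bRec]
  norm_num
  rw [hq0 17 16 (by omega) (by omega),
      hq0 17 15 (by omega) (by omega),
      hq1 17 14 (by omega) (by omega),
      hq1 16 15 (by omega) (by omega),
      hq1 17 13 (by omega) (by omega),
      hq1 16 14 (by omega) (by omega),
      hq1 17 12 (by omega) (by omega),
      hq1 17 11 (by omega) (by omega),
      hq1 16 13 (by omega) (by omega),
      hq1 16 12 (by omega) (by omega),
      hq1 16 11 (by omega) (by omega),
      hq1 15 14 (by omega) (by omega),
      hq1 15 13 (by omega) (by omega),
      hq1 15 12 (by omega) (by omega),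
      hq1 15 11 (by omega) (by omega),
      hq1 14 13 (by omega) (by omega),
      hq1 14 12 (by omega) (by omega),
      hq1 14 11 (by omega) (by omega),
      hq1 13 12 (by omega) (by omega),
      hq1 13 11 (by omega) (by omega),
      hq1 12 11 (by omega) (by omega)]
  norm_num

/-- **PATH on the record cell `9n < p ≤ 10n`**: `⌊d/p⌋ = 2`, `N_p = 19`, `C⋆ ≤ 11`, so the node's value is `≤ 2 − 19 + 6 = −11 ≤ casLB ≤ v_p(Cas₇)`. -/
theorem pathAccounting_bRec_cell0910 (n p : ℕ) (hn : 1 ≤ n) (hprime : p.Prime) (hp9 : 9 * n < p) (hp10 : p ≤ 10 * n)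
    (hwin : (41 * n + 2 : ℤ) < (p : ℤ) ^ 2) (hcas : casoratian (bRec n) 7 ≠ 0) :
    dOf (bRec n) / (p : ℤ) - pairFloors (bRec n) p
        - min (if 2 ≤ dOf (bRec n) / (p : ℤ) then (1 : ℤ) else 0) (5 - (cStar (bRec n) p : ℤ))
      ≤ padicValRat p (casoratian (bRec n) 7) := by
  have hv := cas_ge_neg11 n 7 p hn (by norm_num) (by norm_num) hprime hp9 hp10 hwin hcas
  have hC : (cStar (bRec n) p : ℤ) ≤ 11 := by exact_mod_cast cStar_le_eleven (bRec n) p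
  have hp0 : (0 : ℤ) < p := by exact_mod_cast hprime.pos
  have hfd : dOf (bRec n) / (p : ℤ) = 2 := by
    rw [dOf_bRec]
    apply le_antisymm
    · have : (25 * (n : ℤ)) / (p : ℤ) < 3 := by rw [Int.ediv_lt_iff_lt_mul hp0]; omega
      omega
    · rw [Int.le_ediv_iff_mul_le hp0]; omega
  rw [hfd, if_pos (le_refl _), pairFloors_bRec_0910 hp9 hp10]
  have hmin : -6 ≤ min (1 : ℤ) (5 - (cStar (bRec n) p : ℤ)) := le_min (by norm_num) (by linarith)
  linarith

end Summit.KontsevichZagierPeriods.Zeta5Search.RecordRay0910
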